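import Summits.CriticalPhenomena.CardyFormulaZ2.Theorems.CardyMagicRigidityNestingRigidityNeckZ2VirtualEdges
import Summits.CriticalPhenomena.CardyFormulaZ2.Theorems.CardyMagicRigidityNestingRigidityNeckCoarseZ2Surrogate
import HarnessLib

/-!
# Crux `NestingRigidity`, line `pinch-resampling` (v4), stub S12: the hook-up through BIG blobs on `ℤ²` and the easy half of the sandwich

Crux `Summit.CriticalPhenomena.CardyFormulaZ2.Theses.CardyMagicRigidity.NestingRigidity`
(stmt-CriticalPhenomena-4835), line `pinch-resampling` v4, stub S12 `stub_neckHookupCoarseZ2 : NeckHookupCoarseZ2`.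
`ℤ²` port of road-map item 0 of the S11 analysis (`…NestingRigidityNeckHookStarSandwich`), on top of
`…NeckZ2VirtualEdges`:

* `NeckCoarseZ2.zBigRoute lam s x ω` — the vertices usable by a hook-up THROUGH THE BIG BLOBS: the box `Λ_s(x)`, and the
  collar vertices whose blob is big (sup diameter `≥ lam`) and touches the inner layer; `ZHookBig lam s x` — all open
  crossings of the collar are joined by an open path of such vertices.
* **The easy half of the sandwich** (`NeckCoarseZ2.fuzzyHook_of_zHookBig`, generic in the link graph `Z`): on lattice
  configurations, a hook-up through the big blobs is a FUZZY hook-up — every two big crossing footprints of the coarse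
  datum are related by the equivalence closure of the fuzzy-link relation "inner-layer vertices in cells of the two
  footprints joined by a `Z`-path through `Λ_s(x) ∪ innerLayer`", for every graph `Z` containing the open lattice edges
  meeting the box (for the surrogate `ZHookStar` of `…NeckCoarseZ2Surrogate`, `Z = zIntGraph x s ω`).  Proof: an open
  path of `zBigRoute` vertices decomposes into segments inside big blobs and `Z`-segments through the box, entered and
  left at inner-layer vertices (lattice adjacency to the box), i.e. into honest fuzzy links.
* `NeckCoarseZ2.pathIn_zBigRoute_of_avoid`: an open path of `Λ_{2s}(x)` from a crossing that avoids all SMALL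
  inner-touching blobs runs inside `zBigRoute` (so `ZHookR ∖ ZHookBig` means: the small inner-touching blobs are
  jointly pivotal — the error part `𝔅`, treated by `…NeckZ2CoveringB`).

Hence on lattice configurations `ZFourStrands ∩ (ZHookR Δ ZHookStar) ⊆ 𝔄 ∪ 𝔅` with `𝔄 = ZHookStar ∖ ZHookR`,
`𝔅 = ZHookR ∖ ZHookBig` (assembled in the surrogate's sequel).
-/

noncomputable section

namespace Summit.CriticalPhenomena.CardyFormulaZ2.Cruxes.NestingRigidity.PinchResampling

open MeasureTheory Set Literature.Probability.Percolation Literature.Probability.LatticeModels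
open ZPinchLocality

namespace NeckCoarseZ2

/-- The vertices usable by a **hook-up through the big blobs**: vertices of the box `Λ_s(x)`, and collar vertices of
`Λ_{2s}(x) ∖ Λ_s(x)` whose blob is big (two vertices at sup distance `≥ lam`) and touches the inner layer. -/
def zBigRoute (lam s : ℕ) (x : Site 2) (ω : BondConfig (Site 2)) : Set (Site 2) :=
  {v | v ∈ zBall x (2 * s) ∧ (v ∈ zBall x s ∨
    ((∃ w ∈ blobOf (openGraph ω) (zBall x (2 * s) \ zBall x s) v,
        ∃ w' ∈ blobOf (openGraph ω) (zBall x (2 * s) \ zBall x s) v, (lam : ℤ) ≤ zNorm (w - w')) ∧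
      ∃ w ∈ blobOf (openGraph ω) (zBall x (2 * s) \ zBall x s) v,
        w ∈ innerLayer (zdGraph 2) (zBall x s) (zBall x (2 * s))))}

end NeckCoarseZ2

/-- **`ZHookBig`: the hook-up of `Λ_s(x)` through the box and BIG blobs only** — all open crossings of the collar are
joined by an open path of `zBigRoute` vertices. -/
def ZHookBig (lam s : ℕ) (x : Site 2) : Set (BondConfig (Site 2)) :=
  {ω | ∀ v w, IsCrossing (zdGraph 2) (openGraph ω) (zBall x s) (zBall x (2 * s)) v →
    IsCrossing (zdGraph 2) (openGraph ω) (zBall x s) (zBall x (2 * s)) w →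
    PathIn (openGraph ω) (NeckCoarseZ2.zBigRoute lam s x ω) v w}

/-- A hook-up through big blobs is a hook-up. -/
theorem zHookBig_subset_zHookR (lam s : ℕ) (x : Site 2) : ZHookBig lam s x ⊆ ZHookR x s :=
  fun _ hω v w hv hw ↦ (hω v w hv hw).mono fun _ hz ↦ hz.1

namespace NeckCoarseZ2

variable {ℓ lam s : ℕ} {x o : Site 2} {ω : BondConfig (Site 2)}

/-- The coarse footprint of a big inner-touching blob (given by any of its members `v`) belongs to the coarse datum. -/
theorem footprint_mem_zCoarse {v w₀ : Site 2} (hw₀ : w₀ ∈ blobOf (openGraph ω) (zBall x (2 * s) \ zBall x s) v)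
    (hw₀L : w₀ ∈ innerLayer (zdGraph 2) (zBall x s) (zBall x (2 * s)))
    (hbig : ∃ w ∈ blobOf (openGraph ω) (zBall x (2 * s) \ zBall x s) v,
      ∃ w' ∈ blobOf (openGraph ω) (zBall x (2 * s) \ zBall x s) v, (lam : ℤ) ≤ zNorm (w - w')) :
    cellOf ℓ o '' (blobOf (openGraph ω) (zBall x (2 * s) \ zBall x s) v ∩
        innerLayer (zdGraph 2) (zBall x s) (zBall x (2 * s))) ∈
      (zCoarse ℓ lam s x o ω).1 ∪ (zCoarse ℓ lam s x o ω).2 := by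
  have hbv : blobOf (openGraph ω) (zBall x (2 * s) \ zBall x s) w₀ =
      blobOf (openGraph ω) (zBall x (2 * s) \ zBall x s) v := NeckCoarse.blobOf_eq_of_mem hw₀
  by_cases hcross : ∃ w ∈ blobOf (openGraph ω) (zBall x (2 * s) \ zBall x s) v,
      w ∈ outerLayer (zdGraph 2) (zBall x s) (zBall x (2 * s))
  · left
    refine ⟨w₀, hw₀L, ?_, ?_, ?_⟩ <;> rw [hbv]
    · exact hbig
    · exact hcross
  · right
    push Not at hcross
    refine ⟨w₀, hw₀L, ?_, ?_, ?_⟩ <;> rw [hbv]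
    · exact hbig
    · exact hcross

/-- **The easy half of the sandwich (road map, item 0), generic in the link graph.**  On a lattice configuration, if all
crossings are hooked up through `zBigRoute`, then every two big crossing footprints of the coarse datum are related by
the equivalence closure of the fuzzy-link relation for any link graph `Z` containing the open lattice edges meeting the
box. -/
theorem fuzzyHook_of_zHookBig (hHG : ∀ a b, (openGraph ω).Adj a b → (zdGraph 2).Adj a b) {Z : SimpleGraph (Site 2)}
    (hZ : ∀ a b, (zdGraph 2).Adj a b → s(a, b) ∈ ω → (a ∈ zBall x s ∨ b ∈ zBall x s) → Z.Adj a b)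
    (hB : ω ∈ ZHookBig lam s x) :
    ∀ S ∈ (zCoarse ℓ lam s x o ω).1, ∀ T ∈ (zCoarse ℓ lam s x o ω).1,
      Relation.EqvGen (fun A B ↦ A ∈ (zCoarse ℓ lam s x o ω).1 ∪ (zCoarse ℓ lam s x o ω).2 ∧
        B ∈ (zCoarse ℓ lam s x o ω).1 ∪ (zCoarse ℓ lam s x o ω).2 ∧
        ∃ a ∈ innerLayer (zdGraph 2) (zBall x s) (zBall x (2 * s)),
          ∃ b ∈ innerLayer (zdGraph 2) (zBall x s) (zBall x (2 * s)), cellOf ℓ o a ∈ A ∧ cellOf ℓ o b ∈ B ∧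
            PathIn Z (zBall x s ∪ innerLayer (zdGraph 2) (zBall x s) (zBall x (2 * s))) a b) S T := by
  set K := zBall x s with hK
  set O := zBall x (2 * s) with hO
  set H := openGraph ω with hH
  set IL := innerLayer (zdGraph 2) K O with hIL
  set supp := (zCoarse ℓ lam s x o ω).1 ∪ (zCoarse ℓ lam s x o ω).2 with hsupp
  set Rel : Set (Site 2) → Set (Site 2) → Prop := fun A B ↦ A ∈ supp ∧ B ∈ supp ∧ ∃ a ∈ IL, ∃ b ∈ IL,
    cellOf ℓ o a ∈ A ∧ cellOf ℓ o b ∈ B ∧ PathIn Z (K ∪ IL) a b with hRel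
  -- footprints
  let fp : Site 2 → Set (Site 2) := fun u ↦ cellOf ℓ o '' (blobOf H (O \ K) u ∩ IL)
  have fp_eq : ∀ {u u' : Site 2}, u' ∈ blobOf H (O \ K) u → fp u' = fp u := fun h ↦ by
    simp only [fp, NeckCoarse.blobOf_eq_of_mem h]
  have fp_supp : ∀ {u : Site 2}, u ∈ zBigRoute lam s x ω → u ∉ K → fp u ∈ supp := by
    rintro u ⟨-, hu | ⟨hbig, w₀, hw₀, hw₀L⟩⟩ huK
    · exact (huK hu).elim
    · exact footprint_mem_zCoarse (ℓ := ℓ) (o := o) hw₀ hw₀L hbig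
  have cell_fp : ∀ {u : Site 2}, u ∈ IL → cellOf ℓ o u ∈ fp u := fun hu ↦
    mem_image_of_mem _ ⟨NeckCoarse.self_mem_blobOf hu.1, hu⟩
  -- witnesses of crossing footprints are crossings
  rintro S ⟨a, haL, -, hac, rfl⟩ T ⟨a', ha'L, -, ha'c, rfl⟩
  have hcr : ∀ {v : Site 2}, v ∈ IL → (∃ w ∈ blobOf H (O \ K) v, w ∈ outerLayer (zdGraph 2) K O) →
      IsCrossing (zdGraph 2) H K O v := fun hvL ⟨w, hw, hwo⟩ ↦ ⟨hvL, w, hwo, hw⟩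
  obtain ⟨ha0, p⟩ := hB a a' (hcr haL hac) (hcr ha'L ha'c)
  -- the invariant along the path
  suffices inv : ∀ z, Relation.ReflTransGen (fun u v ↦ H.Adj u v ∧ v ∈ zBigRoute lam s x ω) a z →
      (z ∉ K → Relation.EqvGen Rel (fp a) (fp z)) ∧
      (z ∈ K → ∃ a₁ ∈ IL, fp a₁ ∈ supp ∧ Relation.EqvGen Rel (fp a) (fp a₁) ∧ PathIn Z (K ∪ IL) a₁ z) by
    exact (inv a' p).1 ha'L.1.2
  intro z hz
  induction hz with
  | refl => exact ⟨fun _ ↦ Relation.EqvGen.refl _, fun h ↦ (haL.1.2 h).elim⟩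
  | @tail y z hay hyz ih =>
    obtain ⟨hadj, hzR⟩ := hyz
    have hG : (zdGraph 2).Adj y z := hHG _ _ hadj
    have hopen : s(y, z) ∈ ω := ((openGraph_adj ω y z).1 hadj).1
    have hyR : y ∈ zBigRoute lam s x ω := by
      cases hay with
      | refl => exact ha0
      | tail _ h => exact h.2
    have hyO : y ∈ O := hyR.1
    have hzO : z ∈ O := hzR.1
    by_cases hyK : y ∈ K
    · obtain ⟨a₁, ha₁L, ha₁s, hEq, hpath⟩ := ih.2 hyK
      by_cases hzK : z ∈ K
      · exact ⟨fun h ↦ (h hzK).elim, fun _ ↦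
          ⟨a₁, ha₁L, ha₁s, hEq, hpath.tail (hZ _ _ hG hopen (Or.inl hyK)) (Or.inl hzK)⟩⟩
      · -- leaving the box at the inner-layer vertex `z`: an honest fuzzy link `fp a₁ ~ fp z`
        have hzL : z ∈ IL := NeckCoarse.mem_innerLayer_of_adj ⟨hzO, hzK⟩ hyK hG.symm
        have hpz : PathIn Z (K ∪ IL) a₁ z := hpath.tail (hZ _ _ hG hopen (Or.inl hyK)) (Or.inr hzL)
        have hrel : Rel (fp a₁) (fp z) := ⟨ha₁s, fp_supp hzR hzK, a₁, ha₁L, z, hzL, cell_fp ha₁L, cell_fp hzL, hpz⟩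
        exact ⟨fun _ ↦ hEq.trans _ _ _ (Relation.EqvGen.rel _ _ hrel), fun h ↦ (hzK h).elim⟩
    · have hyA : y ∈ O \ K := ⟨hyO, hyK⟩
      by_cases hzK : z ∈ K
      · -- entering the box from the inner-layer vertex `y`
        have hyL : y ∈ IL := NeckCoarse.mem_innerLayer_of_adj hyA hzK hG
        refine ⟨fun h ↦ (h hzK).elim, fun _ ↦ ⟨y, hyL, fp_supp hyR hyK, ih.1 hyK, ?_⟩⟩
        exact PathIn.of_adj (Or.inr hyL) (Or.inl hzK) (hZ _ _ hG hopen (Or.inr hzK))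
      · -- an open collar edge stays inside the blob
        have hzy : z ∈ blobOf H (O \ K) y := PathIn.of_adj hyA ⟨hzO, hzK⟩ hadj
        refine ⟨fun _ ↦ ?_, fun h ↦ (hzK h).elim⟩
        rw [fp_eq hzy]
        exact ih.1 hyK

/-- **A path of `Λ_{2s}(x)` from a crossing that avoids ALL small inner-touching blobs runs inside `zBigRoute`** (on a
lattice configuration), and its collar vertices have big inner-touching blobs. -/
theorem pathIn_zBigRoute_of_avoid (hHG : ∀ a b, (openGraph ω).Adj a b → (zdGraph 2).Adj a b) {v z : Site 2}
    (hv : IsCrossing (zdGraph 2) (openGraph ω) (zBall x s) (zBall x (2 * s)) v)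
    (hvbig : ∃ w ∈ blobOf (openGraph ω) (zBall x (2 * s) \ zBall x s) v,
      ∃ w' ∈ blobOf (openGraph ω) (zBall x (2 * s) \ zBall x s) v, (lam : ℤ) ≤ zNorm (w - w'))
    (hp : PathIn (openGraph ω) (zBall x (2 * s) \ ⋃ c ∈ {c | c ∈ innerLayer (zdGraph 2) (zBall x s) (zBall x (2 * s)) ∧
      ¬ ∃ w ∈ blobOf (openGraph ω) (zBall x (2 * s) \ zBall x s) c,
        ∃ w' ∈ blobOf (openGraph ω) (zBall x (2 * s) \ zBall x s) c, (lam : ℤ) ≤ zNorm (w - w')},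
        blobOf (openGraph ω) (zBall x (2 * s) \ zBall x s) c) v z) :
    PathIn (openGraph ω) (zBigRoute lam s x ω) v z ∧
      (z ∉ zBall x s → (∃ w ∈ blobOf (openGraph ω) (zBall x (2 * s) \ zBall x s) z,
          w ∈ innerLayer (zdGraph 2) (zBall x s) (zBall x (2 * s))) ∧
        ∃ w ∈ blobOf (openGraph ω) (zBall x (2 * s) \ zBall x s) z,
          ∃ w' ∈ blobOf (openGraph ω) (zBall x (2 * s) \ zBall x s) z, (lam : ℤ) ≤ zNorm (w - w')) := by
  set K := zBall x s with hK
  set O := zBall x (2 * s) with hO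
  set H := openGraph ω with hH
  obtain ⟨hv0, p⟩ := hp
  induction p with
  | refl =>
    have hvA : v ∈ O \ K := hv.1.1
    refine ⟨PathIn.refl ⟨hvA.1, Or.inr ⟨hvbig, v, NeckCoarse.self_mem_blobOf hvA, hv.1⟩⟩, fun _ ↦
      ⟨⟨v, NeckCoarse.self_mem_blobOf hvA, hv.1⟩, hvbig⟩⟩
  | @tail y z hvy hyz ih =>
    obtain ⟨hadj, hzS⟩ := hyz
    have hG : (zdGraph 2).Adj y z := hHG _ _ hadj
    obtain ⟨ihp, ihA⟩ := ih
    have hyO : y ∈ O := (PathIn.right_mem ihp).1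
    have hzO : z ∈ O := hzS.1
    by_cases hzK : z ∈ K
    · exact ⟨ihp.tail hadj ⟨hzO, Or.inl hzK⟩, fun h ↦ (h hzK).elim⟩
    · have hzA : z ∈ O \ K := ⟨hzO, hzK⟩
      -- the blob of `z` touches the inner layer and is big
      have hprops : (∃ w ∈ blobOf H (O \ K) z, w ∈ innerLayer (zdGraph 2) K O) ∧
          ∃ w ∈ blobOf H (O \ K) z, ∃ w' ∈ blobOf H (O \ K) z, (lam : ℤ) ≤ zNorm (w - w') := by
        by_cases hyK : y ∈ K
        · have hzL : z ∈ innerLayer (zdGraph 2) K O := NeckCoarse.mem_innerLayer_of_adj hzA hyK hG.symm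
          refine ⟨⟨z, NeckCoarse.self_mem_blobOf hzA, hzL⟩, ?_⟩
          by_contra hsmall
          refine hzS.2 ?_
          simp only [mem_iUnion, mem_setOf_eq, exists_prop]
          exact ⟨z, ⟨hzL, hsmall⟩, NeckCoarse.self_mem_blobOf hzA⟩
        · obtain ⟨h1, h2⟩ := ihA hyK
          have hzy : blobOf H (O \ K) z = blobOf H (O \ K) y :=
            NeckCoarse.blobOf_eq_of_mem (PathIn.of_adj ⟨hyO, hyK⟩ hzA hadj)
          rw [hzy]
          exact ⟨h1, h2⟩
      exact ⟨ihp.tail hadj ⟨hzO, Or.inr ⟨hprops.2, hprops.1⟩⟩, fun _ ↦ hprops⟩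

end NeckCoarseZ2

/-- **The easy half of the sandwich (registered helper, anchor of this module on the crux item)**: on lattice
configurations a hook-up through the big blobs is a fuzzy hook-up, `ZHookBig ⊆ ZHookStar`
(`NeckCoarseZ2.fuzzyHook_of_zHookBig` with the link graph `zIntGraph x s ω` of `…NeckCoarseZ2Surrogate`). -/
theorem zHookBig_subset_zHookStar : ∀ (ℓ lam s : ℕ) (x o : Site 2) (ω : BondConfig (Site 2)), ω ⊆ (zdGraph 2).edgeSet → ω ∈ ZHookBig lam s x → ω ∈ ZHookStar ℓ lam s x o :=
  fun _ _ s x _ ω hω hB ↦ NeckCoarseZ2.fuzzyHook_of_zHookBig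
    (fun a b h ↦ (SimpleGraph.mem_edgeSet _).1 (hω ((openGraph_adj ω a b).1 h).1)) (Z := zIntGraph x s ω)
    (fun _ _ h1 h2 h3 ↦ ⟨h1, h2, h3⟩) hB

end Summit.CriticalPhenomena.CardyFormulaZ2.Cruxes.NestingRigidity.PinchResampling

end
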